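import Mathlib
import Literature.Analysis.FluidPDE.VectorCalculus
import Summits.NavierStokesRegularity.NavierStokesRegularity.Theorems.ThreadingFluxErtelTowerLaplacianTools
import HarnessLib

/-!
# Crux `PoloidalLiouville` (stmt-NavierStokesRegularity-1222, W1), crux idea «radial-jerk-tower» (ns-idea-15 g7):
# THE STRAIN SHADOW, I — the two transport identities (`⟪B,x⟫ ≡ 0 ⇒ ⟪B,Sx⟫ ≡ 0 ⇒ ⟪B,S²x⟫ = ν div(SB)`)

Support file (`--supports stmt-NavierStokesRegularity-1222`, helper).  Experiment cell `ns-wall-extremal`, width hand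
ns-wall-eng-5 g6, director KEY-NS #186 («V21 radial-jerk-tower sizes go to eng-5 g6»); critic of record ns-wall-crit-1 g4
(V21 PASS-WITH-PRICE; V21-P2 types `StrainShadowClassificationLocal` as the M rung).  0 kit.

First links of the proof chain of `StrainShadowClassification(Local)` (ErtelTowerSketch v1.1 Part B docstring: «`f = ⟪B,x⟫ ≡ 0
⇒ g = ⟪B,Sx⟫ ≡ 0 ⇒ ⟪B,S²x⟫ = ν div(SB)` (the transport equations of `f` and `g`)»), for a jointly smooth `B` on an open
`I × U` solving the passive viscous equation `∂ₜB + DB[Sx] − SB = νΔB` with `div B = 0`: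

* `shadow_transport_zero` / `shadow_transport_one` — the pure-calculus identities
  `(∂ₜ + Sx·∇ − νΔ)⟪B, x⟫ = ⟪∂ₜB + DB[Sx] − νΔB, x⟫ + ⟪B, Sx⟫ − 2ν div B` and
  `(∂ₜ + Sx·∇ − νΔ)⟪B, Sx⟫ = ⟪∂ₜB + DB[Sx] − νΔB, Sx⟫ + ⟪B, S²x⟫ − 2ν div(SB)` (local Leibniz rules of
  `ThreadingFluxErtelTowerLaplacianTools`; `Δ(strain) = 0`; `Σᵢ⟪∂ᵢB, Seᵢ⟫ = div(SB)`);
* ★ `shadow_inner_strain_eq_zero` (`⟪B,x⟫ ≡ 0 ⇒ ⟪B,Sx⟫ ≡ 0`), ★ `shadow_inner_strain_sq_eq` (`⇒ ⟪B,S²x⟫ = ν div(SB)`).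

BOOKING (critic's words, V21-P1/P2/P4): a statement about the LINEAR STRAIN SHADOW of the wall — the passive viscous
equation in the prescribed unbounded drift `Sx` — not about `PoloidalLiouville` ⟨1222⟩ or `UnthreadedRigidity` ⟨27585⟩; helper,
no rung credit on W1 (movement 0); it refutes nothing.  `PoloidalLiouville` (1222) / (27585) OPEN; NS regularity NOT proved.
-/

-- the summit and its single problem share the name (D-0017 nested layout)
set_option linter.dupNamespace false

noncomputable section

namespace Summit.NavierStokesRegularity.NavierStokesRegularity.Theorems.PoloidalLiouville.ErtelTower

open Set Function Filter Topology Metric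
open scoped Topology RealInnerProductSpace InnerProductSpace
open Literature.Analysis.FluidPDE
open Summit.NavierStokesRegularity.NavierStokesRegularity.Theorems.PoloidalLiouville.HorizonTower (E3)

/-! ### The strain shadow: the two transport identities (ErtelTowerSketch, proof chain of `StrainShadowClassification`) -/

section ShadowTransport

variable {ν a b c : ℝ} {B : ℝ → E3 → E3} {I : Set ℝ} {U : Set E3}

/-- `Δ⟪B, y⟫ = ⟪ΔB, x⟫ + 2 div B` locally (centre `0`). -/
theorem laplacian_inner_id_of_contDiffOn {B : E3 → E3} {x : E3} (hU : IsOpen U) (hB : ContDiffOn ℝ (⊤ : ℕ∞) B U)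
    (hx : x ∈ U) :
    Laplacian.laplacian (fun y => inner ℝ (B y) y) x
      = inner ℝ (Laplacian.laplacian B x) x + 2 * Literature.Analysis.FluidPDE.VectorCalculus.divergence B x := by
  simpa using laplacian_inner_sub_const_of_contDiffOn hU hB hx 0

/-- The strain drift is a linear map: `Δ(strain) = 0`. -/
theorem laplacian_strain (a b c : ℝ) (x : E3) : Laplacian.laplacian (strain a b c) x = 0 := by
  obtain ⟨L, hL, -⟩ := hasFDerivAt_strain a b c x
  have h : strain a b c = fun y => L y := funext fun y => (hL y).symm
  rw [h, laplacian_eq_sum_fderiv_fderiv (EuclideanSpace.basisFun (Fin 3) ℝ) L.contDiff x]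
  simp

/-- `Σᵢ ⟪∂ᵢB, S eᵢ⟫ = div (S ∘ B)` at a point where `B` is differentiable (`S` symmetric, constant). -/
theorem sum_inner_fderiv_strain {B : E3 → E3} {x : E3} (hB : DifferentiableAt ℝ B x) :
    ∑ i : Fin 3, inner ℝ (fderiv ℝ B x (EuclideanSpace.single i 1)) (strain a b c (EuclideanSpace.single i 1))
      = Literature.Analysis.FluidPDE.VectorCalculus.divergence (fun z => strain a b c (B z)) x := by
  obtain ⟨L, hL, hLd⟩ := hasFDerivAt_strain a b c (B x)
  have hD : fderiv ℝ (fun z => strain a b c (B z)) x = L.comp (fderiv ℝ B x) := (hLd.comp x hB.hasFDerivAt).fderiv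
  rw [divergence_eq_sum_inner_fderiv (EuclideanSpace.basisFun (Fin 3) ℝ), hD]
  refine Finset.sum_congr rfl fun i _ => ?_
  simp only [EuclideanSpace.basisFun_apply, ContinuousLinearMap.comp_apply, hL]
  rw [real_inner_comm, inner_strain_comm]

/-- **TRANSPORT IDENTITY AT LEVEL 0** (pure calculus): for `B` jointly smooth on the open `I × U` and the strain drift `Sx`,
`(∂ₜ + Sx·∇ − νΔ)⟪B, x⟫ = ⟪∂ₜB + DB[Sx] − νΔB, x⟫ + ⟪B, Sx⟫ − 2ν div B`. -/
theorem shadow_transport_zero (hI : IsOpen I) (hU : IsOpen U)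
    (hB : ContDiffOn ℝ (⊤ : ℕ∞) (Function.uncurry B) (I ×ˢ U)) {t : ℝ} {x : E3} (ht : t ∈ I) (hx : x ∈ U) :
    deriv (fun s => inner ℝ (B s x) x) t
        + inner ℝ (strain a b c x) (gradient (fun z => inner ℝ (B t z) z) x)
        - ν * Laplacian.laplacian (fun z => inner ℝ (B t z) z) x
      = inner ℝ (deriv (fun s => B s x) t + fderiv ℝ (B t) x (strain a b c x) - ν • Laplacian.laplacian (B t) x) x
        + inner ℝ (B t x) (strain a b c x) - 2 * ν * Literature.Analysis.FluidPDE.VectorCalculus.divergence (B t) x := by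
  have hBd : DifferentiableAt ℝ (Function.uncurry B) (t, x) :=
    (contDiffAt_of_contDiffOn_prod hB hI hU ht hx).differentiableAt (by simp)
  have hBt : HasDerivAt (fun s => B s x) (deriv (fun s => B s x) t) t := by
    have h1 : HasDerivAt (fun s : ℝ => (s, x)) (1, 0) t := (hasDerivAt_id t).prodMk (hasDerivAt_const t x)
    exact (hBd.hasFDerivAt.comp_hasDerivAt t h1).differentiableAt.hasDerivAt
  have hBx : HasFDerivAt (B t) (fderiv ℝ (B t) x) x := by
    have h1 : HasFDerivAt (fun w : E3 => (t, w)) (ContinuousLinearMap.inr ℝ ℝ E3) x :=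
      (hasFDerivAt_const t x).prodMk (hasFDerivAt_id x)
    exact (hBd.hasFDerivAt.comp x h1).differentiableAt.hasFDerivAt
  have h1 : deriv (fun s => inner ℝ (B s x) x) t = inner ℝ (deriv (fun s => B s x) t) x := by
    rw [(hBt.inner ℝ (hasDerivAt_const t x)).deriv]; simp
  have h2 : inner ℝ (strain a b c x) (gradient (fun z => inner ℝ (B t z) z) x)
      = inner ℝ (fderiv ℝ (B t) x (strain a b c x)) x + inner ℝ (B t x) (strain a b c x) := by
    have h : HasFDerivAt (fun z : E3 => inner ℝ (B t z) z)
        ((fderivInnerCLM ℝ (B t x, x)).comp ((fderiv ℝ (B t) x).prod (ContinuousLinearMap.id ℝ E3))) x :=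
      hBx.inner ℝ (hasFDerivAt_id x)
    rw [real_inner_comm, _root_.inner_gradient_left, h.fderiv]
    simp [fderivInnerCLM_apply]
    ring
  have h3 := laplacian_inner_id_of_contDiffOn hU (contDiffOn_slice hB ht) hx
  rw [h1, h2, h3, inner_sub_left, inner_add_left, inner_smul_left]
  simp only [conj_trivial]
  ring

/-- **TRANSPORT IDENTITY AT LEVEL 1** (pure calculus): `(∂ₜ + Sx·∇ − νΔ)⟪B, Sx⟫ = ⟪∂ₜB + DB[Sx] − νΔB, Sx⟫ + ⟪B, S²x⟫
− 2ν div(SB)`. -/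
theorem shadow_transport_one (hI : IsOpen I) (hU : IsOpen U)
    (hB : ContDiffOn ℝ (⊤ : ℕ∞) (Function.uncurry B) (I ×ˢ U)) {t : ℝ} {x : E3} (ht : t ∈ I) (hx : x ∈ U) :
    deriv (fun s => inner ℝ (B s x) (strain a b c x)) t
        + inner ℝ (strain a b c x) (gradient (fun z => inner ℝ (B t z) (strain a b c z)) x)
        - ν * Laplacian.laplacian (fun z => inner ℝ (B t z) (strain a b c z)) x
      = inner ℝ (deriv (fun s => B s x) t + fderiv ℝ (B t) x (strain a b c x) - ν • Laplacian.laplacian (B t) x)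
          (strain a b c x)
        + inner ℝ (B t x) (strain a b c (strain a b c x))
        - 2 * ν * Literature.Analysis.FluidPDE.VectorCalculus.divergence (fun z => strain a b c (B t z)) x := by
  have hBd : DifferentiableAt ℝ (Function.uncurry B) (t, x) :=
    (contDiffAt_of_contDiffOn_prod hB hI hU ht hx).differentiableAt (by simp)
  have hBt : HasDerivAt (fun s => B s x) (deriv (fun s => B s x) t) t := by
    have h1 : HasDerivAt (fun s : ℝ => (s, x)) (1, 0) t := (hasDerivAt_id t).prodMk (hasDerivAt_const t x)
    exact (hBd.hasFDerivAt.comp_hasDerivAt t h1).differentiableAt.hasDerivAt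
  have hBx : HasFDerivAt (B t) (fderiv ℝ (B t) x) x := by
    have h1 : HasFDerivAt (fun w : E3 => (t, w)) (ContinuousLinearMap.inr ℝ ℝ E3) x :=
      (hasFDerivAt_const t x).prodMk (hasFDerivAt_id x)
    exact (hBd.hasFDerivAt.comp x h1).differentiableAt.hasFDerivAt
  obtain ⟨L, hL, hLd⟩ := hasFDerivAt_strain a b c x
  have h1 : deriv (fun s => inner ℝ (B s x) (strain a b c x)) t = inner ℝ (deriv (fun s => B s x) t) (strain a b c x) := by
    rw [(hBt.inner ℝ (hasDerivAt_const t (strain a b c x))).deriv]; simp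
  have h2 : inner ℝ (strain a b c x) (gradient (fun z => inner ℝ (B t z) (strain a b c z)) x)
      = inner ℝ (fderiv ℝ (B t) x (strain a b c x)) (strain a b c x)
        + inner ℝ (B t x) (strain a b c (strain a b c x)) := by
    have h : HasFDerivAt (fun z : E3 => inner ℝ (B t z) (strain a b c z))
        ((fderivInnerCLM ℝ (B t x, strain a b c x)).comp ((fderiv ℝ (B t) x).prod L)) x := hBx.inner ℝ hLd
    rw [real_inner_comm, _root_.inner_gradient_left, h.fderiv]
    simp [fderivInnerCLM_apply, hL]
    ring
  -- the Laplacian term: Leibniz with `Δ strain = 0`, `D strain = S`, `Σᵢ ⟪∂ᵢB, S eᵢ⟫ = div(SB)`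
  have hSU : ContDiffOn ℝ (⊤ : ℕ∞) (strain a b c) U := by
    have h : ContDiff ℝ (⊤ : ℕ∞) (strain a b c) := by
      obtain ⟨L', hL', -⟩ := hasFDerivAt_strain a b c 0
      have : strain a b c = fun y => L' y := funext fun y => (hL' y).symm
      rw [this]; exact L'.contDiff
    exact h.contDiffOn
  have hBU : ContDiffOn ℝ (⊤ : ℕ∞) (B t) U := contDiffOn_slice hB ht
  have h3 : Laplacian.laplacian (fun z => inner ℝ (B t z) (strain a b c z)) x
      = inner ℝ (Laplacian.laplacian (B t) x) (strain a b c x)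
        + 2 * Literature.Analysis.FluidPDE.VectorCalculus.divergence (fun z => strain a b c (B t z)) x := by
    rw [laplacian_inner_of_contDiffOn hU hBU hSU hx, laplacian_strain, inner_zero_right, add_zero,
      ← sum_inner_fderiv_strain hBx.differentiableAt]
    congr 2
    refine Finset.sum_congr rfl fun i _ => ?_
    rw [hLd.fderiv, hL]
  rw [h1, h2, h3, inner_sub_left, inner_add_left, inner_smul_left]
  simp only [conj_trivial]
  ring

/-- **LEVEL 0 ⇒ LEVEL 1 in the strain shadow**: a sphere-tangent (`⟪B, x⟫ ≡ 0`) divergence-free solution of the passive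
viscous equation `∂ₜB + DB[Sx] − SB = νΔB` on the open `I × U` is also `S`-tangent: `⟪B, Sx⟫ ≡ 0`. -/
theorem shadow_inner_strain_eq_zero (hI : IsOpen I) (hU : IsOpen U)
    (hB : ContDiffOn ℝ (⊤ : ℕ∞) (Function.uncurry B) (I ×ˢ U))
    (hdiv : ∀ t ∈ I, ∀ x ∈ U, Literature.Analysis.FluidPDE.VectorCalculus.divergence (B t) x = 0)
    (heq : ∀ t ∈ I, ∀ x ∈ U,
      deriv (fun s => B s x) t + fderiv ℝ (B t) x (strain a b c x) - strain a b c (B t x)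
        = ν • Laplacian.laplacian (B t) x)
    (htan : ∀ t ∈ I, ∀ x ∈ U, inner ℝ (B t x) x = 0) :
    ∀ t ∈ I, ∀ x ∈ U, inner ℝ (B t x) (strain a b c x) = 0 := by
  intro t ht x hx
  have hid := shadow_transport_zero (ν := ν) (a := a) (b := b) (c := c) hI hU hB ht hx
  have hev_t : (fun s => inner ℝ (B s x) x) =ᶠ[𝓝 t] fun _ => (0 : ℝ) := by
    filter_upwards [hI.mem_nhds ht] with s hs using htan s hs x hx
  have hev_x : (fun z => inner ℝ (B t z) z) =ᶠ[𝓝 x] fun _ => (0 : ℝ) := by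
    filter_upwards [hU.mem_nhds hx] with z hz using htan t ht z hz
  have h1 : deriv (fun s => inner ℝ (B s x) x) t = 0 := by rw [hev_t.deriv_eq, deriv_const]
  have h2 : gradient (fun z => inner ℝ (B t z) z) x = 0 := by
    rw [(gradient_congr_nhds hev_x).eq_of_nhds]; simp [gradient]
  have h3 : Laplacian.laplacian (fun z => inner ℝ (B t z) z) x = 0 := by
    rw [(InnerProductSpace.laplacian_congr_nhds hev_x).eq_of_nhds]; simp
  have h4 : deriv (fun s => B s x) t + fderiv ℝ (B t) x (strain a b c x) - ν • Laplacian.laplacian (B t) x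
      = strain a b c (B t x) := by
    have h := heq t ht x hx
    rw [sub_eq_iff_eq_add] at h
    rw [h]; abel
  rw [h1, h2, h3, h4, hdiv t ht x hx] at hid
  simp only [inner_zero_right, mul_zero, sub_zero, zero_add] at hid
  rw [inner_strain_comm] at hid
  linarith

/-- **LEVEL 1 ⇒ LEVEL 2 in the strain shadow**: under the same hypotheses, `⟪B, S²x⟫ = ν div(SB)` on `I × U`
(the sketch's third link «`⟪B,S²x⟫ = ν div(SB)`»). -/
theorem shadow_inner_strain_sq_eq (hI : IsOpen I) (hU : IsOpen U)
    (hB : ContDiffOn ℝ (⊤ : ℕ∞) (Function.uncurry B) (I ×ˢ U))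
    (hdiv : ∀ t ∈ I, ∀ x ∈ U, Literature.Analysis.FluidPDE.VectorCalculus.divergence (B t) x = 0)
    (heq : ∀ t ∈ I, ∀ x ∈ U,
      deriv (fun s => B s x) t + fderiv ℝ (B t) x (strain a b c x) - strain a b c (B t x)
        = ν • Laplacian.laplacian (B t) x)
    (htan : ∀ t ∈ I, ∀ x ∈ U, inner ℝ (B t x) x = 0) :
    ∀ t ∈ I, ∀ x ∈ U, inner ℝ (B t x) (strain a b c (strain a b c x))
      = ν * Literature.Analysis.FluidPDE.VectorCalculus.divergence (fun z => strain a b c (B t z)) x := by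
  intro t ht x hx
  have hg : ∀ s ∈ I, ∀ z ∈ U, inner ℝ (B s z) (strain a b c z) = 0 := shadow_inner_strain_eq_zero hI hU hB hdiv heq htan
  have hid := shadow_transport_one (ν := ν) (a := a) (b := b) (c := c) hI hU hB ht hx
  have hev_t : (fun s => inner ℝ (B s x) (strain a b c x)) =ᶠ[𝓝 t] fun _ => (0 : ℝ) := by
    filter_upwards [hI.mem_nhds ht] with s hs using hg s hs x hx
  have hev_x : (fun z => inner ℝ (B t z) (strain a b c z)) =ᶠ[𝓝 x] fun _ => (0 : ℝ) := by
    filter_upwards [hU.mem_nhds hx] with z hz using hg t ht z hz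
  have h1 : deriv (fun s => inner ℝ (B s x) (strain a b c x)) t = 0 := by rw [hev_t.deriv_eq, deriv_const]
  have h2 : gradient (fun z => inner ℝ (B t z) (strain a b c z)) x = 0 := by
    rw [(gradient_congr_nhds hev_x).eq_of_nhds]; simp [gradient]
  have h3 : Laplacian.laplacian (fun z => inner ℝ (B t z) (strain a b c z)) x = 0 := by
    rw [(InnerProductSpace.laplacian_congr_nhds hev_x).eq_of_nhds]; simp
  have h4 : deriv (fun s => B s x) t + fderiv ℝ (B t) x (strain a b c x) - ν • Laplacian.laplacian (B t) x
      = strain a b c (B t x) := by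
    have h := heq t ht x hx
    rw [sub_eq_iff_eq_add] at h
    rw [h]; abel
  rw [h1, h2, h3, h4] at hid
  simp only [inner_zero_right, mul_zero, sub_zero, zero_add] at hid
  rw [inner_strain_comm] at hid
  linarith

end ShadowTransport

end Summit.NavierStokesRegularity.NavierStokesRegularity.Theorems.PoloidalLiouville.ErtelTower
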